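import Summits.NavierStokesRegularity.NavierStokesRegularity.Theorems.ScenarioCensusRowF1StretchedTransfer
import Summits.NavierStokesRegularity.NavierStokesRegularity.Theorems.ScenarioCensusRowF1ColumnarTransfer
import HarnessLib

/-!
# LINE «stretched-top» port, part 4/4: the rows are EXCLUDED (`rowF1sx_holds`, `rowF1lb_holds`, …), the floor `criticallyStretchedTop_holds`, displays,
# `stretchingSlack_iff_rowF1`; census KEYS `Row_F1sx` / `Row_F1ss` / `Row_F1rg` / `Row_F1gsx` / `Row_F1lb` + `_excluded`

Re-homed for the scenario census (typer seat ns-census-typer-1 g7; the cells F1sx ⊇ F1ss ⊇ F1rg, F1gsx, F1lb are MEMBERS OF RECORD «DECIDED IN KERNEL IN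
FILES» of row F1 since census v1.68 (critic idea-crit-3 g6 PASS 19:59:58Z; ref ns-census-ref g8 PRE-CHECK ✓ §13.14 [2/6]; lit §21.20); this port makes
them TREE-decided): VERBATIM PORT of ns-idea-3 LINE 16 «stretched-top», `pub/ideators/ns-idea-3/lines/stretched-top/line-stretched-top.lean` sha16
a94533c1db73adac (912 l., lean check rc 0, 0 sorry), split for the 400-line rule into `ScenarioCensusRowF1Stretched` (§1) → `…StretchedZoom` (§2–§3) →
`…StretchedTransfer` (§4) → `…StretchedTop` (§5 + census KEYS).  Lean text VERBATIM in namespace `…Theorems.ScenarioCensus.StretchedTop` (the line's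
`…Cruxes.ScenarioCensusRowF1.StretchedTopLine` re-homed); port edits: `@[conjecture]` on the residual `StretchingSlack` (≡ `ScenarioCensus.Row_F1`, OPEN).

No census VALUE is moved here (row F1 stays OPEN-WITH-LINE; the members become TREE-decided by name); NS regularity is NOT proved; `Row_F1` is
untouched (zero movement, `stretchingSlack_iff_rowF1`); no summit statement is proved by this file. Lemmas that restate already-landed tree declarations are taken BY NAME (gate lint `dedup.landed`): `tendsto_physicalTime` = `ColumnarTop.tendsto_physicalTime`, `eventually_fast` = `ColumnarTop.eventually_fast`.
-/

-- the summit and its single problem share the name `NavierStokesRegularity` (D-0017 nested layout)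
set_option linter.dupNamespace false

noncomputable section

open MeasureTheory Set Function Filter TopologicalSpace Metric
open scoped Topology NNReal ENNReal InnerProductSpace RealInnerProductSpace Laplacian

namespace Summit.NavierStokesRegularity.NavierStokesRegularity.Theorems.ScenarioCensus.StretchedTop

open Literature.Analysis Literature.Analysis.FluidPDE
open Summit.NavierStokesRegularity.NavierStokesRegularity.Theorems

/-! ## §5 The rows are EXCLUDED; the floor; displays; the residual is exactly `Row_F1` -/

/-- **Criterion row F1sx is EXCLUDED** (in kernel): Type I + sub-critical vortex stretching on the top of a
subcritical level ⇒ extension. -/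
theorem rowF1sx_holds : Row_F1sx := by
  intro ν T hν hT u p hsol hLH hdec hTI hsx
  obtain ⟨Λ, hΛ, θ, hθ, hst⟩ := hsx
  apply hasSmoothExtensionPast_of_forall_exists_parabolicCylinder hν hT hsol hLH hdec
  intro x₀
  by_contra hno
  have hsing : ∀ r : ℝ, 0 < r →
      eLpNorm (uncurry u) ∞ (volume.restrict (parabolicCylinder r ((T : ℝ), x₀))) = ∞ := by
    intro r hr
    by_contra h
    exact hno ⟨r, hr, lt_top_iff_ne_top.2 h⟩
  obtain ⟨C, α, β, R, c, W, hα, hβ, hR, hαR, hcpos, hclim, hW, hpt, hgrad, t, ht, y, hne⟩ :=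
    exists_singularZoom_package hν hT hsol hLH hdec hTI x₀ hsing
  exact hne (typeI_ancient_eq_zero_of_subcriticalStretching hθ hW
    (subcriticalStretching_transfer hα hβ hαR hcpos hclim hW hpt hgrad hΛ hst) t ht y)

/-- **Criterion row F1lb is EXCLUDED** (in kernel): Type I + Lamb slack on the top of a subcritical level ⇒
extension. -/
theorem rowF1lb_holds : Row_F1lb := by
  intro ν T hν hT u p hsol hLH hdec hTI hlb
  obtain ⟨Λ, hΛ, hls⟩ := hlb
  apply hasSmoothExtensionPast_of_forall_exists_parabolicCylinder hν hT hsol hLH hdec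
  intro x₀
  by_contra hno
  have hsing : ∀ r : ℝ, 0 < r →
      eLpNorm (uncurry u) ∞ (volume.restrict (parabolicCylinder r ((T : ℝ), x₀))) = ∞ := by
    intro r hr
    by_contra h
    exact hno ⟨r, hr, lt_top_iff_ne_top.2 h⟩
  obtain ⟨C, α, β, R, c, W, hα, hβ, hR, hαR, hcpos, hclim, hW, hpt, hgrad, t, ht, y, hne⟩ :=
    exists_singularZoom_package hν hT hsol hLH hdec hTI x₀ hsing
  have hL := lambSlack_transfer hα hβ hαR hcpos hclim hpt hgrad hΛ hls
  refine hne (typeI_ancient_eq_zero_of_lamb_eq_zero hW (fun s hs y' => ?_) t ht y)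
  by_cases hy : W s y' = 0
  · rw [hy, ← crossCLM_apply, map_zero]
  · exact hL s hs y' hy

/-- **Criterion row F1ss is EXCLUDED** (in kernel; corollary of `rowF1sx_holds`). -/
theorem rowF1ss_holds : Row_F1ss := rowF1ss_of_rowF1sx rowF1sx_holds

/-- **Criterion row F1rg is EXCLUDED** (in kernel; corollary of `rowF1ss_holds`). -/
theorem rowF1rg_holds : Row_F1rg := rowF1rg_of_rowF1ss rowF1ss_holds

/-- **Criterion row F1gsx is EXCLUDED** (in kernel; corollary of `rowF1sx_holds`). -/
theorem rowF1gsx_holds : Row_F1gsx := rowF1gsx_of_rowF1sx rowF1sx_holds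

/-- **CRITICALLY STRETCHED TOP** (structural theorem, in kernel). -/
theorem criticallyStretchedTop_holds : CriticallyStretchedTop :=
  fun ν T hν hT u p hmax hLH hdec hTI =>
    ⟨fun h => hmax.2 (rowF1sx_holds ν T hν hT u p hmax.1 hLH hdec hTI h),
      fun h => hmax.2 (rowF1lb_holds ν T hν hT u p hmax.1 hLH hdec hTI h)⟩

/-- No Type-I Clay blow-up has a sub-critical strain top. -/
theorem not_hasSubcriticalStrainTop_of_typeI : ∀ (ν T : ℝ), 0 < ν → 0 < T →
    ∀ (u : ℝ → E3 → E3) (p : ℝ → E3 → ℝ),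
    IsMaximalSmoothSolution ν 0 u p T → IsLerayHopfOn T ν 0 (u 0) u →
    HasRapidSpatialDecay (u 0) → IsTypeIBlowup u T → ¬ HasSubcriticalStrainTop T u :=
  fun ν T hν hT u p hmax hLH hdec hTI h =>
    (criticallyStretchedTop_holds ν T hν hT u p hmax hLH hdec hTI).1 h.hasSubcriticallyStretchedTop

/-- No Type-I Clay blow-up has an asymptotically rigid top. -/
theorem not_hasRigidTop_of_typeI : ∀ (ν T : ℝ), 0 < ν → 0 < T →
    ∀ (u : ℝ → E3 → E3) (p : ℝ → E3 → ℝ),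
    IsMaximalSmoothSolution ν 0 u p T → IsLerayHopfOn T ν 0 (u 0) u →
    HasRapidSpatialDecay (u 0) → IsTypeIBlowup u T → ¬ HasRigidTop T u :=
  fun ν T hν hT u p hmax hLH hdec hTI h =>
    not_hasSubcriticalStrainTop_of_typeI ν T hν hT u p hmax hLH hdec hTI h.hasSubcriticalStrainTop

/-- No Type-I Clay blow-up has global sub-critical stretching. -/
theorem not_hasSubcriticalStretching_of_typeI : ∀ (ν T : ℝ), 0 < ν → 0 < T →
    ∀ (u : ℝ → E3 → E3) (p : ℝ → E3 → ℝ),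
    IsMaximalSmoothSolution ν 0 u p T → IsLerayHopfOn T ν 0 (u 0) u →
    HasRapidSpatialDecay (u 0) → IsTypeIBlowup u T → ¬ HasSubcriticalStretching T u :=
  fun ν T hν hT u p hmax hLH hdec hTI h =>
    (criticallyStretchedTop_holds ν T hν hT u p hmax hLH hdec hTI).1 h.hasSubcriticallyStretchedTop

/-- **NEAR-CRITICAL VORTEX STRETCHING ON THE TOP, unfolded** (display form, constant levels): in the maximal
Type-I Clay frame, for EVERY `θ < 1`, EVERY level `Λ` and every `t₁ < T` some time `t ∈ (t₁, T)` has a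
`Λ`-fast point where `(T − t) ⟪∇u ω, ω⟫ > θ ‖ω‖²` — the vortex stretching rate of the fast fluid reaches
`θ/(T − t)` for every `θ < 1`, arbitrarily close to `T`. -/
theorem nearCriticalStretching_unfolded : ∀ (ν T : ℝ), 0 < ν → 0 < T →
    ∀ (u : ℝ → E3 → E3) (p : ℝ → E3 → ℝ),
    IsMaximalSmoothSolution ν 0 u p T → IsLerayHopfOn T ν 0 (u 0) u →
    HasRapidSpatialDecay (u 0) → IsTypeIBlowup u T →
    ∀ θ : ℝ, θ < 1 → ∀ Λ : ℝ, ∀ t₁ : ℝ, t₁ < T →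
      ∃ t ∈ Ioo t₁ T, ∃ x : E3, Λ < ‖u t x‖ ∧
        θ * ‖curl (u t) x‖ ^ 2 < (T - t) * ⟪fderiv ℝ (u t) x (curl (u t) x), curl (u t) x⟫_ℝ := by
  intro ν T hν hT u p hmax hLH hdec hTI θ hθ Λ t₁ ht₁
  by_contra hno
  push Not at hno
  refine (criticallyStretchedTop_holds ν T hν hT u p hmax hLH hdec hTI).1
    ⟨fun _ => Λ, isSubcriticalLevel_const T Λ, θ, hθ, ?_⟩
  exact eventually_of_mem (Ioo_mem_nhdsLT ht₁) fun t ht x hx => hno t ht x hx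

/-- **NEAR-CRITICAL STRETCHING RATE, normalised display**: for `0 ≤ θ < 1`, at the fast point of
`nearCriticalStretching_unfolded` the vorticity is nonzero and the stretching RATE
`σ = ⟪∇u ξ_ω, ξ_ω⟫`, `ξ_ω = ω/‖ω‖`, exceeds `θ/(T − t)`. -/
theorem nearCriticalStretchingRate_unfolded : ∀ (ν T : ℝ), 0 < ν → 0 < T →
    ∀ (u : ℝ → E3 → E3) (p : ℝ → E3 → ℝ),
    IsMaximalSmoothSolution ν 0 u p T → IsLerayHopfOn T ν 0 (u 0) u →
    HasRapidSpatialDecay (u 0) → IsTypeIBlowup u T →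
    ∀ θ : ℝ, 0 ≤ θ → θ < 1 → ∀ Λ : ℝ, ∀ t₁ : ℝ, t₁ < T →
      ∃ t ∈ Ioo t₁ T, ∃ x : E3, Λ < ‖u t x‖ ∧ curl (u t) x ≠ 0 ∧
        θ < (T - t) * ⟪fderiv ℝ (u t) x (vorticityDirection (curl (u t)) x),
          vorticityDirection (curl (u t)) x⟫_ℝ := by
  intro ν T hν hT u p hmax hLH hdec hTI θ hθ0 hθ Λ t₁ ht₁
  obtain ⟨t, ht, x, hx, hlt⟩ :=
    nearCriticalStretching_unfolded ν T hν hT u p hmax hLH hdec hTI θ hθ Λ t₁ ht₁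
  have hω : curl (u t) x ≠ 0 := by
    intro h0
    rw [h0, norm_zero, map_zero, inner_zero_right] at hlt
    simp at hlt
  refine ⟨t, ht, x, hx, hω, ?_⟩
  have hn : 0 < ‖curl (u t) x‖ := norm_pos_iff.2 hω
  rw [vorticityDirection_apply, map_smul, real_inner_smul_left, real_inner_smul_right]
  have e : (T - t) * (‖curl (u t) x‖⁻¹ * (‖curl (u t) x‖⁻¹ *
      ⟪fderiv ℝ (u t) x (curl (u t) x), curl (u t) x⟫_ℝ)) =
      (‖curl (u t) x‖ ^ 2)⁻¹ * ((T - t) * ⟪fderiv ℝ (u t) x (curl (u t) x), curl (u t) x⟫_ℝ) := by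
    field_simp
  rw [e, lt_inv_mul_iff₀ (by positivity : (0 : ℝ) < ‖curl (u t) x‖ ^ 2)]
  linarith

/-- **SUPER-CRITICAL PRINCIPAL STRAIN ON THE TOP, unfolded**: for EVERY `θ < 1` and EVERY level `Λ`,
arbitrarily close to `T` some `Λ`-fast point has a direction `ξ` with `(T − t) ⟪∇u ξ, ξ⟫ > θ ‖ξ‖²`. -/
theorem supercriticalStrain_unfolded : ∀ (ν T : ℝ), 0 < ν → 0 < T →
    ∀ (u : ℝ → E3 → E3) (p : ℝ → E3 → ℝ),
    IsMaximalSmoothSolution ν 0 u p T → IsLerayHopfOn T ν 0 (u 0) u →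
    HasRapidSpatialDecay (u 0) → IsTypeIBlowup u T →
    ∀ θ : ℝ, θ < 1 → ∀ Λ : ℝ, ∀ t₁ : ℝ, t₁ < T →
      ∃ t ∈ Ioo t₁ T, ∃ x : E3, Λ < ‖u t x‖ ∧
        ∃ ξ : E3, θ * ‖ξ‖ ^ 2 < (T - t) * ⟪fderiv ℝ (u t) x ξ, ξ⟫_ℝ := by
  intro ν T hν hT u p hmax hLH hdec hTI θ hθ Λ t₁ ht₁
  by_contra hno
  push Not at hno
  refine not_hasSubcriticalStrainTop_of_typeI ν T hν hT u p hmax hLH hdec hTI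
    ⟨fun _ => Λ, isSubcriticalLevel_const T Λ, θ, hθ, ?_⟩
  exact eventually_of_mem (Ioo_mem_nhdsLT ht₁) fun t ht x hx ξ => hno t ht x hx ξ

/-- **NO RIGID TOP, unfolded**: for EVERY level `Λ` there is an `ε > 0` such that arbitrarily close to `T`
some `Λ`-fast point has a direction `ξ` with `(T − t) |⟪∇u ξ, ξ⟫| > ε ‖ξ‖²` — the fast fluid deforms at the
Type-I rate, it does not merely rotate. -/
theorem noRigidTop_unfolded : ∀ (ν T : ℝ), 0 < ν → 0 < T →
    ∀ (u : ℝ → E3 → E3) (p : ℝ → E3 → ℝ),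
    IsMaximalSmoothSolution ν 0 u p T → IsLerayHopfOn T ν 0 (u 0) u →
    HasRapidSpatialDecay (u 0) → IsTypeIBlowup u T →
    ∀ Λ : ℝ, ∃ ε : ℝ, 0 < ε ∧ ∀ t₁ : ℝ, t₁ < T →
      ∃ t ∈ Ioo t₁ T, ∃ x : E3, Λ < ‖u t x‖ ∧
        ∃ ξ : E3, ε * ‖ξ‖ ^ 2 < (T - t) * |⟪fderiv ℝ (u t) x ξ, ξ⟫_ℝ| := by
  intro ν T hν hT u p hmax hLH hdec hTI Λ
  by_contra hno
  push Not at hno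
  refine not_hasRigidTop_of_typeI ν T hν hT u p hmax hLH hdec hTI
    ⟨fun _ => Λ, isSubcriticalLevel_const T Λ, fun ε hε => ?_⟩
  obtain ⟨t₁, ht₁, h⟩ := hno ε hε
  exact eventually_of_mem (Ioo_mem_nhdsLT ht₁) fun t ht x hx ξ => h t ht x hx ξ

/-- **TYPE-I LAMB VECTOR ON THE TOP, unfolded**: for EVERY level `Λ` there is an `ε > 0` such that
arbitrarily close to `T` some `Λ`-fast point carries a Lamb vector `(T − t)^{3/2} ‖ω × u‖ > ε` — the top of a
Type-I blow-up is NOT asymptotically Beltrami. -/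
theorem typeILambVectorOnTop_unfolded : ∀ (ν T : ℝ), 0 < ν → 0 < T →
    ∀ (u : ℝ → E3 → E3) (p : ℝ → E3 → ℝ),
    IsMaximalSmoothSolution ν 0 u p T → IsLerayHopfOn T ν 0 (u 0) u →
    HasRapidSpatialDecay (u 0) → IsTypeIBlowup u T →
    ∀ Λ : ℝ, ∃ ε : ℝ, 0 < ε ∧ ∀ t₁ : ℝ, t₁ < T →
      ∃ t ∈ Ioo t₁ T, ∃ x : E3, Λ < ‖u t x‖ ∧
        ε < (T - t) * Real.sqrt (T - t) * ‖cross (curl (u t) x) (u t x)‖ := by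
  intro ν T hν hT u p hmax hLH hdec hTI Λ
  by_contra hno
  push Not at hno
  refine (criticallyStretchedTop_holds ν T hν hT u p hmax hLH hdec hTI).2
    ⟨fun _ => Λ, isSubcriticalLevel_const T Λ, fun ε hε => ?_⟩
  obtain ⟨t₁, ht₁, h⟩ := hno ε hε
  exact eventually_of_mem (Ioo_mem_nhdsLT ht₁) fun t ht x hx => h t ht x hx

/-- **Row F1 ≡ StretchingSlack** (exact reformulation, in kernel). -/
theorem stretchingSlack_iff_rowF1 : StretchingSlack ↔ ScenarioCensus.Row_F1 :=
  ⟨fun h => rowF1_of rowF1gsx_holds h, stretchingSlack_of_rowF1⟩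

/-- **Composition concluding the target BY NAME**: `StretchingSlack → Row_F1`. -/
theorem rowF1_of_stretchingSlack : StretchingSlack → ScenarioCensus.Row_F1 :=
  stretchingSlack_iff_rowF1.1

end Summit.NavierStokesRegularity.NavierStokesRegularity.Theorems.ScenarioCensus.StretchedTop

namespace Summit.NavierStokesRegularity.NavierStokesRegularity.Theorems.ScenarioCensus

/-! ## Census KEYS (ns `…Theorems.ScenarioCensus`): the STRETCHED-TOP family of row F1 — TREE-decided members -/

/-- **Cell F1sx** (row F1 frame VERBATIM + sub-critical vortex stretching on the fast set ⇒ smooth extension past `T`): `:= StretchedTop.Row_F1sx`. DECIDED. -/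
def Row_F1sx : Prop := StretchedTop.Row_F1sx
/-- F1sx is EXCLUDED (decided in the tree): `StretchedTop.rowF1sx_holds`. -/
theorem row_F1sx_excluded : Row_F1sx := StretchedTop.rowF1sx_holds

/-- **Cell F1ss** (⊆ F1sx): `:= StretchedTop.Row_F1ss`. DECIDED. -/
def Row_F1ss : Prop := StretchedTop.Row_F1ss
/-- F1ss is EXCLUDED (decided in the tree): `StretchedTop.rowF1ss_holds`. -/
theorem row_F1ss_excluded : Row_F1ss := StretchedTop.rowF1ss_holds

/-- **Cell F1rg** (⊆ F1ss): `:= StretchedTop.Row_F1rg`. DECIDED. -/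
def Row_F1rg : Prop := StretchedTop.Row_F1rg
/-- F1rg is EXCLUDED (decided in the tree): `StretchedTop.rowF1rg_holds`. -/
theorem row_F1rg_excluded : Row_F1rg := StretchedTop.rowF1rg_holds

/-- **Cell F1gsx** (`(T−t)⟪∇u ω, ω⟫ ≤ θ|ω|²` on the fast set): `:= StretchedTop.Row_F1gsx`. DECIDED. -/
def Row_F1gsx : Prop := StretchedTop.Row_F1gsx
/-- F1gsx is EXCLUDED (decided in the tree): `StretchedTop.rowF1gsx_holds`. -/
theorem row_F1gsx_excluded : Row_F1gsx := StretchedTop.rowF1gsx_holds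

/-- **Cell F1lb** (vanishing Lamb-vector condition on the top): `:= StretchedTop.Row_F1lb`. DECIDED. -/
def Row_F1lb : Prop := StretchedTop.Row_F1lb
/-- F1lb is EXCLUDED (decided in the tree): `StretchedTop.rowF1lb_holds`. -/
theorem row_F1lb_excluded : Row_F1lb := StretchedTop.rowF1lb_holds

/-- **Floor CRITICALLY STRETCHED TOP** at the level of the census keys: `StretchedTop.criticallyStretchedTop_holds`. -/
theorem row_F1_criticallyStretchedTop : StretchedTop.CriticallyStretchedTop := StretchedTop.criticallyStretchedTop_holds

end Summit.NavierStokesRegularity.NavierStokesRegularity.Theorems.ScenarioCensus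

end
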